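import Summits.NavierStokesRegularity.NavierStokesRegularity.Theorems.ExtremiserTransienceNearExtremalTransiencePerFlowOfFilamentSelectionAllTime
import Summits.NavierStokesRegularity.NavierStokesRegularity.Theorems.ExtremiserTransienceBackwardConePropagation
import HarnessLib

/-!
# LINE g10-α «dissipation ledger» — crux `NearExtremalTransiencePerFlow` (item stmt-NavierStokesRegularity-26567)

Route `ExtremiserTransience`; ideator seat ns-idea-5, generation g10, technique card «extremal-example mining» (the extremal
examples mined: the g8/g9 instrument readings — periodic 3D crowds `R ≈ 0.126–0.129`, dense chains `0.075–0.096`, isolated cells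
`≈ 0.089`, `κ⋆ ≥ 0.1247` certified (j320466) — and the NECKLACE BRIEF of `Lines/filament_selection.lean` §2f).  NO SUMMIT IS PROVED BY
A LINE; this file is a checked skeleton: three registered stubs (C1 heart, L1, L2 analytic), the ledger packing lemma L3 and the glue C2
PROVED in-file (rev 3), and a kernel-checked composition concluding the crux BY NAME.

## The lever (new on this crux): ENERGY PER UNIT LENGTH IS A FINITE, NON-RENEWABLE RESOURCE BACKWARD IN TIME

Every object the route's violator frame produces lives, after the NS-compatible zoom, inside a Type-I ancient mild field `W`
(`‖W τ‖_∞ ≤ K/√(-τ)`) whose slices ALL have linear local-energy growth `∫_{B(x,R)}‖W τ‖² ≤ A·R` (F1 + G′, landed).  The local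
energy inequality then caps the space-time DISSIPATION of a parabolic cylinder linearly in its radius (L1 `DissipationBudget`:
`∬_{[τ₁,τ₂]×B(x,R)} ‖∇W‖² ≤ E·R` whenever `-τ₁ ≤ R²`; the cubic and pressure fluxes integrate `(-τ)^{-1/2}`, no logarithm), while
every scale-invariant LEVEL-`ε` POINT (`√(-τ)‖W τ x‖ > ε`) SPENDS a fixed amount `c·√(-τ)` of it in its own parabolic box
(L2 `ViolatorDissipation`: largeness on `B(x, r₀√(-τ))` persists for `a(-τ)` in time by the scale-invariant derivative bounds,
and linear growth forces `‖W‖` to drop along most rays within `D√(-τ)`, so `∫‖∂_r W‖² r² dr ≳ ε² r₀/(-τ)` per ray).  Level-`ε`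
points PROPAGATE BACKWARD along 36-adic epochs with parabolic drift (landed `ScrewSymmetricLiouville.exists_backwardCone_violator`,
p695049).  THE LEDGER (L3 `LedgerCount`, elementary packing): if the slice `W s` has level points near EVERY sphere about a centre
(«radially ubiquitous»), then at epoch `k` (time `36^k s`, length `L_k = 6^k√(-s)`) a ball of radius `R₀` still contains
`≳ R₀/L_k` separated level points, each spending `c·L_k`: every epoch spends `≳ c·R₀` — a FIXED FRACTION OF THE WHOLE BUDGET
`E·R₀` — and `⌈E/c⌉ + 1` epochs overdraw it.  Hence (kernel-checked here from L1–L3 + the landed propagation):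

  `UbiquitousSliceLiouville`: no slice of a Type-I ancient mild field with all-time linear growth is radially ubiquitous.

This sits exactly at the log-divergent borderline of Tsai's local-energy Liouville class (Tsai 1998 Thm 2: `∫_{B_R}|u|² = o(R)` ⇒
trivial for self-similar profiles; here `≍ R` is allowed and the conclusion is weaker: quiet shells at some radius, every time).

## How it reaches the crux WITHOUT coherent selection (T1 / T1_zoom are NOT used)

The zoom family `v n` of a violator (T0 + T2′, landed) is near-extremal (`deficit → 0`) at height `1` with uniform `C^k` bounds AND
linear growth `A` (F1 + `ballEnergy_zoom_le`, landed).  The one STATIC HEART of the line is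

  C1 `NearExtremiserUbiquity`: `∀ Λ Θ A ∃ g ∀ d ∃ ε > 0`: an `ε`-near-extremal admissible height-1 field with `C^k` bounds `Λ`, Taylor
  bound `Θ` and linear growth `A` contains a centre `y` whose `g`-thickened spheres of ALL radii `r ≤ d` meet the half-height set
  `{‖v‖ ≥ 1/2}` («near-extremisers contain radially ubiquitous chains of length d(ε) → ∞»).

Why plausible: under linear growth a `g`-cluster of `N` near-top cells has diameter `≳ N` (energy per length), so C1 says exactly
«`κ⋆` is a collective phenomenon: efficiency `→ κ⋆` forces clusters with unboundedly many cells»; its contrapositive for bounded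
clusters is DECOUPLING (solenoidal cut-offs in the inter-cluster gaps `> g`, CS-concavity = landed `noDudLaw`, external strain of far
cells `O(A/g²)` by linear growth) + the landed `sparseAnalyticGap_holds` / `not_attained_of_analyticOnNhd` for each localised cluster.
Why it might fail: a hierarchically DILUTE near-extremal family (clusters bounded at every linking scale, separations → ∞) — the
instrument says isolated cells/small clusters are the LEAST efficient objects (`≤ 0.096 < 0.1247 ≤ κ⋆`), but no theorem yet bounds
dilute configurations away from `κ⋆`; the rate competition «decoupling error(g)» vs «bounded-cluster gap(d)» is the crux of C1.
C1 is WEAKER than g9-α's heart F2 `ChainGap` (F2 makes C1's hypothesis eventually vacuous) and independent of δ/β's T1.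

Centring the zoom on C1's centres (diagonal in `d`), flow-level compactness (T2′) and the glue C2 `UbiquityToLimit` (equicontinuity
+ compactness of shells; PROVED in §2, `ubiquityToLimit_holds`) make the limit slice `W s` radially ubiquitous with all-time growth (G′) — contradicting
`UbiquitousSliceLiouville`.  Composition: `NearExtremalTransiencePerFlow_of : C1 → L1 → L2 → NearExtremalTransiencePerFlow` (C2, L3 discharged in-file).

## Honest sizes.  C1 = the heart (static, wall-ADJACENT on the upper-bound side only through the bounded-cluster gap; XL).
C2 glue S/M — PROVED (rev 3).  L1 provable L (local energy inequality for `A_K` fields: classical on windows `IsTypeIAncientMild.exists_isClassicalNSSolutionOn_Ioo`,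
Riesz pressure `pressure_eq_pressurePotentialMod_add_const`, `exists_isLocalEnergySolutionOn_of_oseenForward`; near/far pressure split).
L2 provable M (KNSS bootstrap bounds `KNSSBootstrap.exists_norm_iteratedFDeriv_slice_le` rescaled + polar Cauchy–Schwarz).
L3 provable S/M (pure packing lemma about a measure on `ℝ × ℝ³`; no analysis; proof in its docstring).

## Falsifiers / instrument.  Cheapest falsifier of the LINE: a DILUTE near-extremiser — pre-registered instrument row «DILUTE-GAP»
(card §Instrument): efficiency of `N ≤ 8` unit cells at mutual spacing `d/λ ∈ {3,5,8,12}` in the period box vs the dense-chain value;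
C1 predicts `R(dilute) ≤ R(single cell) + O((λ/d)²) ≈ 0.09 ≪ 0.1247`.  A reading `R(dilute) ≥ R(dense chain)` at large `d` refutes the
mechanism behind C1.  Cheapest falsifier of the LEDGER: none in the class — `UbiquitousSliceLiouville` is implied by the bounded-ancient
Liouville conjecture and consistent with every known ancient solution (constants and 2D/axisymmetric-no-swirl fields violate linear growth
or are zero, KNSS 2009 Thms 1.1–1.3).

Disproof record: `Cruxes/NearExtremalTransiencePerFlow/` has NO `Disproof.lean` (nor has the parent crux `NearExtremalTransience`), so
there is no `_false_without_` theorem to honour (rev 3 corrects the rev 1–2 sentence here); for the record, this line uses the Type-I RATE in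
F1/T0/T2′/L1/L2 and in the propagation theorem, and the EFFICIENCY clause in T0 and C1 — dropping either makes the skeleton inapplicable.
Negatives index (`ledger negatives`): no refuted statement concerns linear-growth ancient fields, dissipation budgets or ubiquity;
the refuted crowd statement (`…OfCrowdRefutation`) concerned UNRESTRICTED near-extremal families — C1 carries the growth hypothesis
that excludes 3D crowds (`N^{2/3} ≤ A g Λ³/c`).
-/

noncomputable section

open scoped Topology InnerProductSpace RealInnerProductSpace ENNReal ContDiff
open MeasureTheory Filter Set Metric Function
open Literature.Analysis Literature.Analysis.FluidPDE
open Summit.NavierStokesRegularity.NavierStokesRegularity.Theses.ExtremiserTransience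
open Summit.NavierStokesRegularity.NavierStokesRegularity.Theorems
open Summit.NavierStokesRegularity.NavierStokesRegularity.Theorems.DepletionLadder.KStar.HalfSpace
open Summit.NavierStokesRegularity.NavierStokesRegularity.Theorems.NearExtremalTransiencePerFlow.ZoneTransversality
open Summit.NavierStokesRegularity.NavierStokesRegularity.Theorems.NearExtremalTransiencePerFlow.MemberSelection
open Summit.NavierStokesRegularity.NavierStokesRegularity.Theorems.NearExtremalTransiencePerFlow

namespace Summit.NavierStokesRegularity.NavierStokesRegularity.Cruxes.NearExtremalTransiencePerFlow.DissipationLedger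

set_option linter.dupNamespace false

/-! ## §0 Vocabulary -/

/-- LINEAR LOCAL-ENERGY GROWTH AT EVERY TIME of an ancient field (unit viscosity): `∫_{B(x,R)}‖W τ‖² ≤ A·R` for all `τ < 0`,
all centres, all radii (the written-out `HasLinGrowth A (W τ)` of g9-β, delivered for zoom limits by the landed G′ `growthTransferFlow`). -/
def HasLinGrowthAllTime (A : ℝ) (W : ℝ → E3 → E3) : Prop :=
  ∀ τ : ℝ, τ < 0 → ∀ (x : E3) (R : ℝ), 0 < R → ∫ z in Metric.ball x R, ‖W τ z‖ ^ 2 ≤ A * R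

/-- A slice is RADIALLY UBIQUITOUS at thickness `g` and level `η` (about the origin): the level set `{‖w‖ ≥ η}` meets the
`g`-neighbourhood of EVERY sphere `{‖z‖ = r}`, `r ≥ 0`.  An infinite `g`-connected chain of level points through the origin has it;
so does every lattice-periodic pattern of level points (after centring).  Its negation: SOME shell `{ |‖z‖ - r| ≤ g }` is quiet. -/
def RadiallyUbiquitous (g η : ℝ) (w : E3 → E3) : Prop :=
  ∀ r : ℝ, 0 ≤ r → ∃ z : E3, |‖z‖ - r| ≤ g ∧ η ≤ ‖w z‖

/-- The SPACE-TIME DISSIPATION MEASURE of a field `W : ℝ → ℝ³ → ℝ³`: Lebesgue measure on `ℝ × ℝ³` with density `‖∇W(τ)(x)‖²`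
(operator norm of the Fréchet derivative of the slice).  On a measurable set `S`, `dissMeasure W S = ∫⁻_{(τ,x) ∈ S} ‖fderiv ℝ (W τ) x‖ₑ²`
(`MeasureTheory.withDensity_apply`); being a measure it is monotone and additive over disjoint boxes — all the ledger uses. -/
def dissMeasure (W : ℝ → E3 → E3) : Measure (ℝ × E3) :=
  (volume : Measure (ℝ × E3)).withDensity fun p => ‖fderiv ℝ (W p.1) p.2‖ₑ ^ 2

/-! ## §1 The five statements of the line (L3 and C2 are proved in §2; C1, L1, L2 are the registered stubs of §3) -/

/-- (L1 — provable, L) DISSIPATION BUDGET: a Type-I ancient mild field with all-time linear growth `A` dissipates at most `E·R` in every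
parabolic cylinder `[τ₁,τ₂] × B(x,R)` with `-τ₁ ≤ R²` (`τ₁ < τ₂ < 0`).  Local energy inequality with a cut-off adapted to `B(x,2R)`:
initial energy `≤ 2AR`; `|W|²Δφ`-term `≤ 2A(τ₂-τ₁)/R ≤ 2AR`; cubic flux `≤ ∫ (K/√(-τ))·2A dτ ≤ 4AK√(-τ₁) ≤ 4AKR`; pressure = Riesz
pressure mod constants (landed `pressure_eq_pressurePotentialMod_add_const` for the classical windows of
`IsTypeIAncientMild.exists_isClassicalNSSolutionOn_Ioo`), near part like the cubic term, far part `∇p_far = O(KA/(R²√(-τ)))`.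
Why it might fail: it does not (KNSS-class local energy theory); size is the only risk. -/
def DissipationBudget : Prop :=
  ∀ (K A : ℝ) (W : ℝ → E3 → E3), IsTypeIAncientMild K W → HasLinGrowthAllTime A W →
    ∃ E : ℝ, ∀ (x : E3) (R τ₁ τ₂ : ℝ), 0 < R → τ₁ < τ₂ → τ₂ < 0 → -τ₁ ≤ R ^ 2 →
      dissMeasure W (Set.Icc τ₁ τ₂ ×ˢ Metric.ball x R) ≤ ENNReal.ofReal (E * R)

/-- (L2 — provable, M) A LEVEL POINT SPENDS DISSIPATION: for `K, A, ε > 0` there are `c, D > 0` and `0 < a < 1` such that for every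
Type-I ancient mild field `W` (constant `K`) with all-time linear growth `A`, every level point `√(-τ)‖W τ x‖ > ε` forces
`∬_{[(1+a)τ, τ] × B(x, D√(-τ))} ‖∇W‖² ≥ c√(-τ)`.  Sketch (`L = √(-τ)`): `|∇W| ≤ K₁/L²`, `|∂_τ W| ≤ K₂/L³` on the box (KNSS bootstrap
`KNSSBootstrap.exists_norm_iteratedFDeriv_slice_le` + NS scaling + the equation) keep `‖W‖ ≥ ε/(2L)` on `B(x, εL/(4K₁))` for times in
`[(1+a)τ, τ]`, `a = ε/(4K₂)`; linear growth gives mean `‖W‖² ≤ 3A/(4πD²L²) < (ε/8L)²` on `B(x,DL)` for `D ≫ √A/ε`, so on half of the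
rays from `x` the modulus drops by `ε/(4L)` inside `[r₀, DL]`, whence `∫ ‖∂_r W‖² r² dr ≥ (ε/4L)² r₀` per ray (Cauchy–Schwarz) and
`∫_{B(x,DL)} ‖∇W(τ')‖² ≥ 2π (ε/4L)² · εL/(4K₁)` for each of the `aL²` times.  Why it might fail: it does not; the constants are explicit. -/
def ViolatorDissipation : Prop :=
  ∀ (K A ε : ℝ), 0 < ε → ∃ (c D a : ℝ), 0 < c ∧ 0 < D ∧ 0 < a ∧ a < 1 ∧
    ∀ (W : ℝ → E3 → E3), IsTypeIAncientMild K W → HasLinGrowthAllTime A W →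
      ∀ (τ : ℝ) (x : E3), τ < 0 → ε < Real.sqrt (-τ) * ‖W τ x‖ →
        ENNReal.ofReal (c * Real.sqrt (-τ)) ≤
          dissMeasure W (Set.Icc ((1 + a) * τ) τ ×ˢ Metric.ball x (D * Real.sqrt (-τ)))

/-- (L3 — provable, S/M; pure packing, no analysis) THE LEDGER COUNT.  Data: a measure `μ` on `ℝ × ℝ³`, a space-time predicate `P`
(«level point»), a time `s < 0`, thickness `g ≥ 0` and constants.  Hypotheses: (U) `P`-points at time `s` near every sphere about `0`;
(Per) one-step backward propagation `P τ x ⇒ P (36τ) x'` with `‖x' - x‖ ≤ ρ√(-τ)`; (Spend) a `P`-point at `(τ,x)` gives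
`μ([(1+a)τ, τ] × B(x, D√(-τ))) ≥ c√(-τ)`; (Budget) `μ([τ₁,τ₂] × B(0,R)) ≤ E·R` when `-τ₁ ≤ R²`.  Conclusion: `False`.
PROOF (typed below as `ledgerCount_holds`, kernel-checked, no `sorry`): put `L_k = 6^k √(-s)`, `σ_k = 2g + (2ρ + 2D)·L_k ≤ Γ L_k`
(`Γ = 2g/L_0 + 2ρ + 2D`); by (U) pick `z_i^k` with `|‖z_i^k‖ - iσ_k| ≤ g`, `i < m_k = ⌊R₀/σ_k⌋`, pairwise `≥ σ_k - 2g` apart; iterate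
(Per) `k` times: `x_i^k` with `P (36^k s) x_i^k` and `‖x_i^k - z_i^k‖ ≤ ρ L_k` (induction: `2ρL_j ≤ ρL_{j+1}`); the boxes
`[(1+a)36^k s, 36^k s] × B(x_i^k, D L_k)` are pairwise disjoint (same `k`: centres `≥ 2D L_k` apart; different `k`: `36 > 1 + a`
separates the time intervals) and lie in `[(1+a)36^{k₁} s, s] × B(0, R)` for `R = R₀ + g + (ρ + D + 2) L_{k₁}` (so `-τ₁ ≤ 4L_{k₁}² ≤ R²`);
additivity and (Spend)/(Budget) give `Σ_{k ≤ k₁} m_k c L_k ≤ max(E,0)·R`, i.e. `(k₁+1)(c R₀/Γ - c L_{k₁}) ≤ max(E,0)·(R₀ + g + (ρ+D+2) L_{k₁})`,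
false for `k₁ = ⌈Γ(max(E,0)+1)/c⌉` and `R₀ = σ_0 + E'g + (E'(ρ+D+2) + (k₁+1)c)L_{k₁} + 1`.  It is NOT a stub. -/
def LedgerCount : Prop :=
  ∀ (μ : Measure (ℝ × E3)) (P : ℝ → E3 → Prop) (s g ρ c D a E : ℝ),
    s < 0 → 0 ≤ g → 0 < ρ → 0 < c → 0 < D → 0 < a → a < 1 →
    (∀ r : ℝ, 0 ≤ r → ∃ z : E3, |‖z‖ - r| ≤ g ∧ P s z) →
    (∀ (τ : ℝ) (x : E3), τ < 0 → P τ x → ∃ x' : E3, ‖x' - x‖ ≤ ρ * Real.sqrt (-τ) ∧ P (36 * τ) x') →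
    (∀ (τ : ℝ) (x : E3), τ < 0 → P τ x →
      ENNReal.ofReal (c * Real.sqrt (-τ)) ≤ μ (Set.Icc ((1 + a) * τ) τ ×ˢ Metric.ball x (D * Real.sqrt (-τ)))) →
    (∀ (R τ₁ τ₂ : ℝ), 0 < R → τ₁ < τ₂ → τ₂ < 0 → -τ₁ ≤ R ^ 2 →
      μ (Set.Icc τ₁ τ₂ ×ˢ Metric.ball (0 : E3) R) ≤ ENNReal.ofReal (E * R)) →
    False

/-- (THE INTERMEDIATE LIOUVILLE THEOREM — kernel-checked below from L1, L2, L3 and the landed backward-cone propagation)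
UBIQUITOUS-SLICE LIOUVILLE: no slice `W s` (`s < 0`) of a Type-I ancient mild field with all-time linear local-energy growth is radially
ubiquitous at any thickness `g` and any level `η > 0`.  Equivalently: every slice has a QUIET SHELL `{ |‖z‖ - r| ≤ g } ∩ {‖W s‖ ≥ η} = ∅`
at some radius, about every centre.  Kills every ancient NECKLACE whose slice is an infinite connected (or lattice-like) chain of cells —
in particular every DSS / self-similar candidate with a chain slice — without any symmetry hypothesis (compare the symmetric rungs R1–R8 of
g9-β, which need a period, a screw or an axis). -/
def UbiquitousSliceLiouville : Prop :=
  ∀ (K A g η : ℝ) (W : ℝ → E3 → E3) (s : ℝ), IsTypeIAncientMild K W → s < 0 → 0 < η →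
    HasLinGrowthAllTime A W → ¬ RadiallyUbiquitous g η (W s)

/-- (C1 — THE STATIC HEART, XL) NEAR-EXTREMISERS WITH LINEAR GROWTH CONTAIN RADIALLY UBIQUITOUS CHAINS: for all derivative bounds `Λ`,
Taylor constant `Θ` and growth constant `A` there is a thickness `g > 0` such that for every length `d` some deficit `ε > 0` suffices:
every smooth divergence-free height-`1` field with `‖D^k v‖ ≤ Λ k`, finite `Ḣ¹, Ḣ²` budgets, `0 < √Z√P`, efficiency
`(κ⋆ - ε)√Z√P ≤ |J(v)|` at height `1`, Taylor bound `Z ≤ Θ P` and linear growth `∫_{B(x,R)}‖v‖² ≤ A R` has a centre `y` such that the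
half-height set `{‖v‖ ≥ 1/2}` meets the `g`-neighbourhood of every sphere `{‖z - y‖ = r}`, `0 ≤ r ≤ d`.
Why it might fail: hierarchically dilute near-extremisers (bounded clusters at every linking scale) are not excluded by any theorem;
the line's bet (instrument: single cells `≈ 0.089–0.096`, small clusters gapped, crowds forbidden by linear growth; theory: decoupling +
`sparseAnalyticGap_holds`) is that `κ⋆ ≥ 0.1247` needs unboundedly many cells in ONE cluster, which linear growth stretches into a chain.
Sources: this seat's instrument records j320466/j321232 (HOME `inst/`), `Lines/sparse_bangbang.lean` (S-E/S-B), `Lines/filament_gap.lean` (F2 ⇒ C1). -/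
def NearExtremiserUbiquity : Prop :=
  ∀ (Λ : ℕ → ℝ) (Θ A : ℝ), ∃ g : ℝ, 0 < g ∧ ∀ d : ℝ, ∃ ε : ℝ, 0 < ε ∧
    ∀ (v : E3 → E3), ContDiff ℝ (⊤ : ℕ∞) v → Literature.Analysis.FluidPDE.VectorCalculus.IsDivFree v → (∀ x, ‖v x‖ ≤ 1) →
      (∀ (k : ℕ) (x : E3), ‖iteratedFDeriv ℝ k v x‖ ≤ Λ k) →
      (∫⁻ x, ‖iteratedFDeriv ℝ 1 v x‖ₑ ^ 2 < ⊤) → (∫⁻ x, ‖iteratedFDeriv ℝ 2 v x‖ₑ ^ 2 < ⊤) →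
      0 < Real.sqrt (∫ x, ‖curl v x‖ ^ 2) * Real.sqrt (∫ x, frobeniusNormSq (fderiv ℝ (curl v) x)) →
      (kStar - ε) * Real.sqrt (∫ x, ‖curl v x‖ ^ 2) * Real.sqrt (∫ x, frobeniusNormSq (fderiv ℝ (curl v) x)) ≤
        |∫ x, ⟪curl v x, fderiv ℝ v x (curl v x)⟫_ℝ| →
      (∫ x, ‖curl v x‖ ^ 2) ≤ Θ * ∫ x, frobeniusNormSq (fderiv ℝ (curl v) x) →
      (∀ (x : E3) (R : ℝ), 0 < R → ∫ z in Metric.ball x R, ‖v z‖ ^ 2 ≤ A * R) →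
      ∃ y : E3, ∀ r : ℝ, 0 ≤ r → r ≤ d → ∃ z : E3, |‖z - y‖ - r| ≤ g ∧ (1 / 2 : ℝ) ≤ ‖v z‖

/-- (C2 — glue, PROVED below: `ubiquityToLimit_holds`) UBIQUITY PASSES TO POINTWISE LIMITS OF TRANSLATES: if the `v n` are smooth with `‖Dv n‖ ≤ Λ₁` (equi-Lipschitz),
the member `v n` is ubiquitous about `y n` up to radius `d n → ∞` at thickness `g`, level `η`, and the translates `v n (y n + ·)` converge
pointwise to `w`, then `w` is radially ubiquitous at thickness `g + 1` and level `η/2` (for each `r`: the points `z n - y n` lie in the compact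
shell `{ |‖ζ‖ - r| ≤ g }`, a subsequence converges to `ζ`, and `‖v n (y n + ζ)‖ ≥ η - Λ₁‖ζ - (z n - y n)‖ → ≥ η`).  Why it might fail: it does not. -/
def UbiquityToLimit : Prop :=
  ∀ (v : ℕ → E3 → E3) (Λ₁ g η : ℝ) (y : ℕ → E3) (d : ℕ → ℝ) (w : E3 → E3),
    (∀ n, ContDiff ℝ (⊤ : ℕ∞) (v n)) → (∀ n (x : E3), ‖iteratedFDeriv ℝ 1 (v n) x‖ ≤ Λ₁) →
    Tendsto d atTop atTop →
    (∀ n, ∀ r : ℝ, 0 ≤ r → r ≤ d n → ∃ z : E3, |‖z - y n‖ - r| ≤ g ∧ η ≤ ‖v n z‖) →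
    (∀ z : E3, Tendsto (fun n => v n (y n + z)) atTop (𝓝 (w z))) →
    RadiallyUbiquitous (g + 1) (η / 2) w

/-! ## §2 The ledger: L1 + L2 + L3 + backward-cone propagation ⇒ `UbiquitousSliceLiouville` (kernel-checked, no `sorry`) -/

/-- **Ubiquitous-slice Liouville from the ledger.**  The level is `ε = min(ε₁, η√(-s)/2)` (`ε₁` the universal constant of
`exists_backwardCone_violator`), so that every half-height point of the ubiquity hypothesis is a level point and the propagation applies. -/
theorem ubiquitousSliceLiouville_of_ledger (h3 : LedgerCount) (h1 : DissipationBudget) (h2 : ViolatorDissipation) :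
    UbiquitousSliceLiouville := by
  intro K A g η W s hW hs hη hgr hub
  have hg : 0 ≤ g := by
    obtain ⟨z, hz, -⟩ := hub 0 le_rfl
    exact (abs_nonneg _).trans hz
  obtain ⟨ε₁, hε₁, hper⟩ := ScrewSymmetricLiouville.exists_backwardCone_violator
  have hsq : 0 < Real.sqrt (-s) := Real.sqrt_pos.2 (neg_pos.2 hs)
  obtain ⟨ε, hε, hεε₁, hεη⟩ : ∃ ε : ℝ, 0 < ε ∧ ε ≤ ε₁ ∧ ε < η * Real.sqrt (-s) := by
    refine ⟨min ε₁ (η * Real.sqrt (-s) / 2), lt_min hε₁ (by positivity), min_le_left _ _, ?_⟩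
    have h1 : η * Real.sqrt (-s) / 2 < η * Real.sqrt (-s) := half_lt_self (by positivity)
    exact lt_of_le_of_lt (min_le_right _ _) h1
  obtain ⟨ρ, hρ, hρW⟩ := hper ε hε hεε₁ K
  obtain ⟨c, D, a, hc, hD, ha, ha1, hsp⟩ := h2 K A ε hε
  obtain ⟨E, hE⟩ := h1 K A W hW hgr
  refine h3 (dissMeasure W) (fun τ x => ε < Real.sqrt (-τ) * ‖W τ x‖) s g ρ c D a E hs hg hρ hc hD ha ha1 ?_ ?_ ?_ ?_
  · intro r hr
    obtain ⟨z, hz, hzη⟩ := hub r hr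
    refine ⟨z, hz, ?_⟩
    show ε < Real.sqrt (-s) * ‖W s z‖
    calc ε < η * Real.sqrt (-s) := hεη
      _ = Real.sqrt (-s) * η := mul_comm _ _
      _ ≤ Real.sqrt (-s) * ‖W s z‖ := by gcongr
  · intro τ x hτ hP
    exact hρW W hW τ hτ x hP
  · intro τ x hτ hP
    exact hsp W hW hgr τ x hτ hP
  · intro R τ₁ τ₂ hR h12 h2' hτR
    exact hE 0 R τ₁ τ₂ hR h12 h2' hτR

set_option maxHeartbeats 1600000 in
/-- **L3 is a THEOREM** (elementary packing, kernel-checked; no `sorry`): the ledger arithmetic of the line. -/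
theorem ledgerCount_holds : LedgerCount := by
  intro μ P s g ρ c D a E hs hg hρ hc hD ha ha1 hU hPer hSp hBud
  -- ### scales: `L0 = √(-s)`, epoch lengths `L k = 6^k L0`, epoch times `τ k = 36^k s`
  obtain ⟨L0, hL0⟩ : ∃ L0 : ℝ, L0 = Real.sqrt (-s) := ⟨_, rfl⟩
  have hL0pos : 0 < L0 := by rw [hL0]; exact Real.sqrt_pos.2 (neg_pos.2 hs)
  have hL0sq : L0 ^ 2 = -s := by rw [hL0]; exact Real.sq_sqrt (neg_pos.2 hs).le
  obtain ⟨L, hL⟩ : ∃ L : ℕ → ℝ, ∀ k, L k = 6 ^ k * L0 := ⟨_, fun _ => rfl⟩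
  obtain ⟨τ, hτ⟩ : ∃ τ : ℕ → ℝ, ∀ k, τ k = 36 ^ k * s := ⟨_, fun _ => rfl⟩
  have hLpos : ∀ k, 0 < L k := fun k => by rw [hL]; positivity
  have hτneg : ∀ k, τ k < 0 := fun k => by rw [hτ]; exact mul_neg_of_pos_of_neg (by positivity) hs
  have h36 : ∀ k : ℕ, (36 : ℝ) ^ k = (6 ^ k) ^ 2 := fun k => by
    rw [← pow_mul, mul_comm, pow_mul]; norm_num
  have hsqrtτ : ∀ k, Real.sqrt (-(τ k)) = L k := by
    intro k
    rw [hτ, hL, hL0, show -(36 ^ k * s) = ((6 : ℝ) ^ k) ^ 2 * (-s) by rw [h36]; ring,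
      Real.sqrt_mul (sq_nonneg _), Real.sqrt_sq (by positivity)]
  have hLsq : ∀ k, L k ^ 2 = -(τ k) := fun k => by
    rw [hL, hτ, mul_pow, ← h36, hL0sq]; ring
  have hLmono : ∀ {k k' : ℕ}, k ≤ k' → L k ≤ L k' := by
    intro k k' hkk'
    rw [hL, hL]
    exact mul_le_mul_of_nonneg_right (pow_le_pow_right₀ (by norm_num) hkk') hL0pos.le
  have hL0le : ∀ k, L0 ≤ L k := fun k => by
    have h0 : L 0 = L0 := by rw [hL]; simp
    rw [← h0]; exact hLmono (Nat.zero_le k)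
  have hτmono : ∀ {k k' : ℕ}, k ≤ k' → τ k' ≤ τ k := by
    intro k k' hkk'
    rw [hτ, hτ]
    exact mul_le_mul_of_nonpos_right (pow_le_pow_right₀ (by norm_num) hkk') hs.le
  have hτles : ∀ k, τ k ≤ s := fun k => by
    rw [hτ]; exact mul_le_of_one_le_left hs.le (one_le_pow₀ (by norm_num))
  -- ### iterated backward propagation with parabolic drift `≤ ρ L k`
  have hiter : ∀ (k : ℕ) (z : E3), P s z → ∃ x : E3, ‖x - z‖ ≤ ρ * L k ∧ P (τ k) x := by
    intro k
    induction k with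
    | zero =>
      intro z hz
      refine ⟨z, ?_, ?_⟩
      · rw [sub_self, norm_zero]; exact (mul_pos hρ (hLpos 0)).le
      · rw [hτ]; simpa using hz
    | succ k ih =>
      intro z hz
      obtain ⟨x, hxz, hPx⟩ := ih z hz
      obtain ⟨x', hx'x, hPx'⟩ := hPer (τ k) x (hτneg k) hPx
      refine ⟨x', ?_, ?_⟩
      · rw [hsqrtτ k] at hx'x
        have h6 : L (k + 1) = 6 * L k := by rw [hL, hL, pow_succ]; ring
        calc ‖x' - z‖ ≤ ‖x' - x‖ + ‖x - z‖ := norm_sub_le_norm_sub_add_norm_sub _ _ _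
          _ ≤ ρ * L k + ρ * L k := add_le_add hx'x hxz
          _ ≤ ρ * L (k + 1) := by rw [h6]; nlinarith [hLpos k, hρ]
      · have e : 36 * τ k = τ (k + 1) := by rw [hτ, hτ, pow_succ]; ring
        rw [← e]; exact hPx'
  -- ### spacings `σ k`, the comparison constant `Γ`, the number of epochs `k₁`, the radius `R₀`
  obtain ⟨σ, hσ⟩ : ∃ σ : ℕ → ℝ, ∀ k, σ k = 2 * g + 2 * ρ * L k + 2 * D * L k := ⟨_, fun _ => rfl⟩
  have hσpos : ∀ k, 0 < σ k := fun k => by rw [hσ]; nlinarith [hLpos k, hρ, hD]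
  obtain ⟨E', hE'0, hEE'⟩ : ∃ E' : ℝ, 0 ≤ E' ∧ E ≤ E' := ⟨max E 0, le_max_right _ _, le_max_left _ _⟩
  obtain ⟨Γ, hΓ⟩ : ∃ Γ : ℝ, Γ = 2 * g / L0 + 2 * ρ + 2 * D := ⟨_, rfl⟩
  have hΓpos : 0 < Γ := by rw [hΓ]; positivity
  have hσΓ : ∀ k, σ k ≤ Γ * L k := by
    intro k
    have h1 : 2 * g ≤ 2 * g / L0 * L k := by
      rw [div_mul_eq_mul_div, le_div_iff₀ hL0pos]
      exact mul_le_mul_of_nonneg_left (hL0le k) (by positivity)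
    rw [hσ, hΓ]; nlinarith [h1, hLpos k]
  obtain ⟨k₁, hk₁⟩ : ∃ k₁ : ℕ, Γ * (E' + 1) / c ≤ (k₁ : ℝ) := ⟨_, Nat.le_ceil _⟩
  have hcoef : (E' + 1) * Γ ≤ ((k₁ : ℝ) + 1) * c := by
    have h1 := (div_le_iff₀ hc).1 hk₁
    nlinarith [hc, hΓpos, hE'0]
  obtain ⟨R₀, hR₀⟩ : ∃ R₀ : ℝ, R₀ = σ 0 + E' * g + (E' * (ρ + D + 2) + ((k₁ : ℝ) + 1) * c) * L k₁ + 1 :=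
    ⟨_, rfl⟩
  have hR₀A : 0 ≤ (E' * (ρ + D + 2) + ((k₁ : ℝ) + 1) * c) * L k₁ :=
    mul_nonneg (by positivity) (hLpos k₁).le
  have hR₀B : 0 ≤ E' * g := mul_nonneg hE'0 hg
  have hR₀pos : 0 < R₀ := by
    rw [hR₀]; linarith [hσpos 0, hR₀A, hR₀B]
  have hR₀σ : σ 0 ≤ R₀ := by
    rw [hR₀]; linarith [hR₀A, hR₀B]
  obtain ⟨m, hm⟩ : ∃ m : ℕ → ℕ, ∀ k, m k = ⌊R₀ / σ k⌋₊ := ⟨_, fun _ => rfl⟩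
  have hmle : ∀ k, (m k : ℝ) ≤ R₀ / σ k := fun k => by
    rw [hm]; exact Nat.floor_le (div_nonneg hR₀pos.le (hσpos k).le)
  have hmge : ∀ k, R₀ / σ k - 1 ≤ (m k : ℝ) := fun k => by
    rw [hm]; exact (Nat.sub_one_lt_floor _).le
  obtain ⟨R, hR⟩ : ∃ R : ℝ, R = R₀ + g + (ρ + D + 2) * L k₁ := ⟨_, rfl⟩
  have hRpos : 0 < R := by rw [hR]; nlinarith [hLpos k₁, hρ, hD]
  -- ### points near the spheres at time `s` and their propagated level points at the epochs
  have hz : ∀ (k i : ℕ), ∃ z : E3, |‖z‖ - i * σ k| ≤ g ∧ P s z := fun k i =>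
    hU (i * σ k) (mul_nonneg (Nat.cast_nonneg i) (hσpos k).le)
  choose z hzr hzP using hz
  have hx : ∀ (k i : ℕ), ∃ x : E3, ‖x - z k i‖ ≤ ρ * L k ∧ P (τ k) x := fun k i => hiter k (z k i) (hzP k i)
  choose x hxz hxP using hx
  -- ### the boxes
  obtain ⟨B, hB⟩ : ∃ B : ℕ → ℕ → Set (ℝ × E3),
      ∀ k i, B k i = Set.Icc ((1 + a) * τ k) (τ k) ×ˢ Metric.ball (x k i) (D * L k) := ⟨_, fun _ _ => rfl⟩
  have hBmeas : ∀ k i, MeasurableSet (B k i) := fun k i => by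
    rw [hB]; exact measurableSet_Icc.prod measurableSet_ball
  have hBspend : ∀ k i, ENNReal.ofReal (c * L k) ≤ μ (B k i) := by
    intro k i
    have h := hSp (τ k) (x k i) (hτneg k) (hxP k i)
    rw [hsqrtτ k] at h
    rw [hB]; exact h
  -- separation within an epoch
  have hsep : ∀ k i i', i < i' → Disjoint (Metric.ball (x k i) (D * L k)) (Metric.ball (x k i') (D * L k)) := by
    intro k i i' hii'
    apply Metric.ball_disjoint_ball
    have hi : (i : ℝ) + 1 ≤ i' := by exact_mod_cast hii'
    have h1 := abs_le.1 (hzr k i)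
    have h2 := abs_le.1 (hzr k i')
    have hzz : σ k - 2 * g ≤ ‖z k i' - z k i‖ := by
      have h3 := norm_sub_norm_le (z k i') (z k i)
      nlinarith [h1.2, h2.1, hσpos k]
    have hxx : ‖z k i' - z k i‖ ≤ ‖x k i' - x k i‖ + ρ * L k + ρ * L k := by
      have e : z k i' - z k i = (x k i' - x k i) - (x k i' - z k i') + (x k i - z k i) := by abel
      rw [e]
      calc ‖(x k i' - x k i) - (x k i' - z k i') + (x k i - z k i)‖
          ≤ ‖(x k i' - x k i) - (x k i' - z k i')‖ + ‖x k i - z k i‖ := norm_add_le _ _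
        _ ≤ ‖x k i' - x k i‖ + ‖x k i' - z k i'‖ + ‖x k i - z k i‖ := by
            gcongr; exact norm_sub_le _ _
        _ ≤ _ := by linarith [hxz k i, hxz k i']
    rw [dist_eq_norm, norm_sub_rev]
    have e := hσ k
    linarith
  -- separation of the time intervals across epochs
  have htime : ∀ k k', k < k' → Disjoint (Set.Icc ((1 + a) * τ k) (τ k)) (Set.Icc ((1 + a) * τ k') (τ k')) := by
    intro k k' hkk'
    rw [Set.disjoint_left]
    intro p hp hp'
    have h1 : τ k' ≤ 36 * τ k := by
      have e : 36 * τ k = τ (k + 1) := by rw [hτ, hτ, pow_succ]; ring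
      rw [e]; exact hτmono (Nat.succ_le_of_lt hkk')
    have h2 : 36 * τ k < (1 + a) * τ k := by nlinarith [hτneg k]
    linarith [hp.1, hp'.2, h1, h2]
  -- ### the index set: epochs `k ≤ k₁`, sphere indices `i < m k`
  obtain ⟨I, hI⟩ : ∃ I : Finset ((_ : ℕ) × ℕ), I = (Finset.range (k₁ + 1)).sigma fun k => Finset.range (m k) :=
    ⟨_, rfl⟩
  have hmemI : ∀ p ∈ I, p.1 ≤ k₁ ∧ p.2 < m p.1 := by
    intro p hp
    rw [hI, Finset.mem_sigma, Finset.mem_range, Finset.mem_range] at hp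
    exact ⟨Nat.le_of_lt_succ hp.1, hp.2⟩
  have hpd : Set.PairwiseDisjoint (↑I : Set ((_ : ℕ) × ℕ)) (fun p => B p.1 p.2) := by
    intro p _ q _ hpq
    obtain ⟨k, i⟩ := p
    obtain ⟨k', i'⟩ := q
    show Disjoint (B k i) (B k' i')
    rw [hB, hB, Set.disjoint_prod]
    rcases lt_trichotomy k k' with hlt | heq | hgt
    · exact Or.inl (htime k k' hlt)
    · subst heq
      right
      rcases lt_trichotomy i i' with hlt' | heq' | hgt'
      · exact hsep k i i' hlt'
      · exact absurd (by subst heq'; rfl) hpq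
      · exact (hsep k i' i hgt').symm
    · exact Or.inl (htime k' k hgt).symm
  -- ### every box lies in the big cylinder `[(1+a) τ k₁, s] × B(0, R)`
  have hBsub : ∀ p ∈ I, B p.1 p.2 ⊆ Set.Icc ((1 + a) * τ k₁) s ×ˢ Metric.ball (0 : E3) R := by
    intro p hp
    obtain ⟨hk, hi⟩ := hmemI p hp
    rw [hB]
    refine Set.prod_mono (Set.Icc_subset_Icc ?_ (hτles _)) ?_
    · exact mul_le_mul_of_nonneg_left (hτmono hk) (by linarith)
    · apply Metric.ball_subset_ball'
      rw [dist_eq_norm, sub_zero]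
      have h1 := abs_le.1 (hzr p.1 p.2)
      have hiσ : (p.2 : ℝ) * σ p.1 ≤ R₀ := by
        have h2 : (p.2 : ℝ) ≤ m p.1 := by exact_mod_cast hi.le
        have h3 := hmle p.1
        rw [le_div_iff₀ (hσpos _)] at h3
        nlinarith [hσpos p.1]
      have hxle : ‖x p.1 p.2‖ ≤ ‖x p.1 p.2 - z p.1 p.2‖ + ‖z p.1 p.2‖ := norm_le_norm_sub_add _ _
      have hLk := hLmono hk
      rw [hR]
      nlinarith [hxz p.1 p.2, h1.2, hD, hρ, hLpos p.1]
  -- ### the ledger inequality in `ℝ≥0∞`, then in `ℝ`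
  have hτ1s : (1 + a) * τ k₁ < s := by
    have h1 : (1 + a) * τ k₁ < τ k₁ := by nlinarith [hτneg k₁]
    exact h1.trans_le (hτles k₁)
  have hτR : -((1 + a) * τ k₁) ≤ R ^ 2 := by
    have h1 : -((1 + a) * τ k₁) = (1 + a) * L k₁ ^ 2 := by rw [hLsq]; ring
    have h2 : 2 * L k₁ ≤ R := by
      have h3 : 0 ≤ (ρ + D) * L k₁ := mul_nonneg (by linarith) (hLpos k₁).le
      have h4 : (ρ + D + 2) * L k₁ = (ρ + D) * L k₁ + 2 * L k₁ := by ring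
      rw [hR]; linarith [hLpos k₁, hR₀pos, hg, h3, h4]
    have h3 : (2 * L k₁) ^ 2 ≤ R ^ 2 := pow_le_pow_left₀ (by linarith [hLpos k₁]) h2 2
    have h4 : (1 + a) * L k₁ ^ 2 ≤ (2 * L k₁) ^ 2 := by
      rw [show (2 * L k₁) ^ 2 = 4 * L k₁ ^ 2 by ring]
      exact mul_le_mul_of_nonneg_right (by linarith) (sq_nonneg _)
    rw [h1]; linarith
  have key : ENNReal.ofReal (∑ p ∈ I, c * L p.1) ≤ ENNReal.ofReal (E' * R) := by
    calc ENNReal.ofReal (∑ p ∈ I, c * L p.1)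
        = ∑ p ∈ I, ENNReal.ofReal (c * L p.1) :=
          ENNReal.ofReal_sum_of_nonneg fun p _ => (mul_pos hc (hLpos _)).le
      _ ≤ ∑ p ∈ I, μ (B p.1 p.2) := Finset.sum_le_sum fun p _ => hBspend p.1 p.2
      _ = μ (⋃ p ∈ I, B p.1 p.2) := (measure_biUnion_finset hpd fun p _ => hBmeas p.1 p.2).symm
      _ ≤ μ (Set.Icc ((1 + a) * τ k₁) s ×ˢ Metric.ball (0 : E3) R) :=
          measure_mono (Set.iUnion₂_subset fun p hp => hBsub p hp)
      _ ≤ ENNReal.ofReal (E * R) := hBud R _ _ hRpos hτ1s hs hτR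
      _ ≤ ENNReal.ofReal (E' * R) := ENNReal.ofReal_le_ofReal (mul_le_mul_of_nonneg_right hEE' hRpos.le)
  have hS : ∑ p ∈ I, c * L p.1 = ∑ k ∈ Finset.range (k₁ + 1), (m k : ℝ) * (c * L k) := by
    rw [hI, Finset.sum_sigma]
    refine Finset.sum_congr rfl fun k _ => ?_
    show ∑ i ∈ Finset.range (m k), c * L k = _
    rw [Finset.sum_const, Finset.card_range, nsmul_eq_mul]
  -- per-epoch spending `≥ c R₀/Γ - c L k₁`
  have hep : ∀ k ∈ Finset.range (k₁ + 1), c * R₀ / Γ - c * L k₁ ≤ (m k : ℝ) * (c * L k) := by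
    intro k hk
    have hk' : k ≤ k₁ := Nat.le_of_lt_succ (Finset.mem_range.1 hk)
    have h1 : R₀ / (Γ * L k) ≤ R₀ / σ k := div_le_div_of_nonneg_left hR₀pos.le (hσpos k) (hσΓ k)
    have h2 := hmge k
    have h3 : R₀ / (Γ * L k) * (c * L k) = c * R₀ / Γ := by
      field_simp [(hLpos k).ne', hΓpos.ne']
    have h4 : (R₀ / (Γ * L k) - 1) * (c * L k) ≤ (m k : ℝ) * (c * L k) :=
      mul_le_mul_of_nonneg_right (by linarith) (mul_pos hc (hLpos k)).le
    have h5 := hLmono hk'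
    nlinarith [h3, h4, hc]
  have hSge : ((k₁ : ℝ) + 1) * (c * R₀ / Γ - c * L k₁) ≤ ∑ p ∈ I, c * L p.1 := by
    rw [hS]
    have h := Finset.sum_le_sum hep
    rw [Finset.sum_const, Finset.card_range, nsmul_eq_mul] at h
    push_cast at h
    linarith
  -- the contradiction
  have hfin : ∑ p ∈ I, c * L p.1 ≤ E' * R ∨ ∑ p ∈ I, c * L p.1 ≤ 0 := ENNReal.ofReal_le_ofReal_iff'.1 key
  have hgap : E' * R < ((k₁ : ℝ) + 1) * (c * R₀ / Γ - c * L k₁) := by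
    have h1 : (E' + 1) * R₀ ≤ ((k₁ : ℝ) + 1) * (c * R₀ / Γ) := by
      have h2 : ((k₁ : ℝ) + 1) * (c * R₀ / Γ) = ((k₁ : ℝ) + 1) * c / Γ * R₀ := by ring
      rw [h2]
      refine mul_le_mul_of_nonneg_right ?_ hR₀pos.le
      rw [le_div_iff₀ hΓpos]; exact hcoef
    rw [hR]
    have h3 : R₀ = σ 0 + E' * g + (E' * (ρ + D + 2) + ((k₁ : ℝ) + 1) * c) * L k₁ + 1 := hR₀
    nlinarith [h1, hσpos 0, hE'0, hLpos k₁]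
  have hERnn : 0 ≤ E' * R := mul_nonneg hE'0 hRpos.le
  rcases hfin with h | h <;> linarith

/-- Equi-Lipschitz from the first-derivative bound (mean value inequality; `‖fderiv‖ = ‖iteratedFDeriv 1‖`). -/
theorem lipschitz_of_iteratedFDeriv_one {f : E3 → E3} {Λ₁ : ℝ} (hf : ContDiff ℝ (⊤ : ℕ∞) f)
    (hΛ : ∀ x, ‖iteratedFDeriv ℝ 1 f x‖ ≤ Λ₁) (a b : E3) : ‖f a - f b‖ ≤ Λ₁ * ‖a - b‖ := by
  have hdiff : ∀ x ∈ (Set.univ : Set E3), DifferentiableAt ℝ f x := fun x _ =>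
    (hf.differentiable (by simp)).differentiableAt
  have hbound : ∀ x ∈ (Set.univ : Set E3), ‖fderiv ℝ f x‖ ≤ Λ₁ := by
    intro x _
    have h : ‖fderiv ℝ f x‖ = ‖iteratedFDeriv ℝ 1 f x‖ := by
      rw [← norm_iteratedFDeriv_fderiv, norm_iteratedFDeriv_zero]
    rw [h]; exact hΛ x
  exact convex_univ.norm_image_sub_le_of_norm_fderiv_le hdiff hbound (Set.mem_univ b) (Set.mem_univ a)

/-- **C2 is a THEOREM** (rev 3; kernel-checked, no `sorry`): ubiquity passes to pointwise limits of translates.  For a radius `r`: eventually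
`d n ≥ r`, so along a subsequence there are level points `z n` with `|‖z n - y n‖ - r| ≤ g`; the relative positions lie in the compact ball
`‖ζ‖ ≤ r + g`, a further subsequence converges to `ζ⋆` with `|‖ζ⋆‖ - r| ≤ g`, and equi-Lipschitz gives
`‖v n (y n + ζ⋆)‖ ≥ η - Λ₁‖ζ⋆ - ζ n‖ → η`, so `‖w ζ⋆‖ ≥ η ≥ η/2`. -/
theorem ubiquityToLimit_holds : UbiquityToLimit := by
  intro v Λ₁ g η y d w hcd hΛ hd hub hconv r hr
  -- eventually the member is ubiquitous up to radius `r`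
  have hev : ∀ᶠ n in atTop, ∃ z : E3, |‖z - y n‖ - r| ≤ g ∧ η ≤ ‖v n z‖ := by
    filter_upwards [hd.eventually_ge_atTop r] with n hn
    exact hub n r hr hn
  obtain ⟨φ₀, hφ₀, hP⟩ := extraction_of_eventually_atTop hev
  choose z hz using hP
  -- the relative positions live in a compact ball
  set ζ : ℕ → E3 := fun n => z n - y (φ₀ n) with hζdef
  have hζmem : ∀ n, ζ n ∈ Metric.closedBall (0 : E3) (r + g) := by
    intro n
    rw [Metric.mem_closedBall, dist_zero_right]
    have h := (abs_le.1 (hz n).1).2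
    show ‖z n - y (φ₀ n)‖ ≤ r + g
    linarith
  obtain ⟨ζs, -, ψ, hψ, hζs⟩ := (isCompact_closedBall (0 : E3) (r + g)).tendsto_subseq hζmem
  -- the limit position is within `g` of the sphere of radius `r`
  have hshell : |‖ζs‖ - r| ≤ g := by
    have h1 : Tendsto (fun n => |‖ζ (ψ n)‖ - r|) atTop (𝓝 |‖ζs‖ - r|) :=
      ((continuous_abs.tendsto _).comp ((continuous_norm.tendsto _).comp hζs |>.sub_const r))
    exact le_of_tendsto' h1 fun n => (hz (ψ n)).1
  -- the value of the limit field there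
  have hconv' : Tendsto (fun n => ‖v (φ₀ (ψ n)) (y (φ₀ (ψ n)) + ζs)‖) atTop (𝓝 ‖w ζs‖) :=
    ((hconv ζs).comp ((hφ₀.comp hψ).tendsto_atTop)).norm
  have hlow : Tendsto (fun n => η - Λ₁ * ‖ζs - ζ (ψ n)‖) atTop (𝓝 η) := by
    have h1 : Tendsto (fun n => ζs - ζ (ψ n)) atTop (𝓝 (ζs - ζs)) := tendsto_const_nhds.sub hζs
    rw [sub_self] at h1
    have h2 : Tendsto (fun n => ‖ζs - ζ (ψ n)‖) atTop (𝓝 0) := by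
      simpa using h1.norm
    have h3 : Tendsto (fun n => η - Λ₁ * ‖ζs - ζ (ψ n)‖) atTop (𝓝 (η - Λ₁ * 0)) :=
      tendsto_const_nhds.sub (tendsto_const_nhds.mul h2)
    simpa using h3
  have hle : ∀ n, η - Λ₁ * ‖ζs - ζ (ψ n)‖ ≤ ‖v (φ₀ (ψ n)) (y (φ₀ (ψ n)) + ζs)‖ := by
    intro n
    have hlip := lipschitz_of_iteratedFDeriv_one (hcd (φ₀ (ψ n))) (hΛ (φ₀ (ψ n)))
      (y (φ₀ (ψ n)) + ζs) (y (φ₀ (ψ n)) + ζ (ψ n))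
    have hzeq : y (φ₀ (ψ n)) + ζ (ψ n) = z (ψ n) := by
      show y (φ₀ (ψ n)) + (z (ψ n) - y (φ₀ (ψ n))) = z (ψ n)
      abel
    rw [hzeq, show y (φ₀ (ψ n)) + ζs - z (ψ n) = ζs - ζ (ψ n) by
      show y (φ₀ (ψ n)) + ζs - z (ψ n) = ζs - (z (ψ n) - y (φ₀ (ψ n))); abel] at hlip
    have hη := (hz (ψ n)).2
    have htri : ‖v (φ₀ (ψ n)) (z (ψ n))‖ - ‖v (φ₀ (ψ n)) (y (φ₀ (ψ n)) + ζs) - v (φ₀ (ψ n)) (z (ψ n))‖ ≤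
        ‖v (φ₀ (ψ n)) (y (φ₀ (ψ n)) + ζs)‖ := by
      have := norm_sub_norm_le (v (φ₀ (ψ n)) (z (ψ n))) (v (φ₀ (ψ n)) (y (φ₀ (ψ n)) + ζs))
      rw [norm_sub_rev] at this
      linarith
    linarith
  have hwη : η ≤ ‖w ζs‖ := le_of_tendsto_of_tendsto' hlow hconv' hle
  refine ⟨ζs, ?_, ?_⟩
  · linarith [hshell, abs_nonneg (‖ζs‖ - r)]
  · rcases le_or_gt 0 η with h | h
    · linarith
    · linarith [norm_nonneg (w ζs)]

/-- The intermediate Liouville theorem from the two ANALYTIC stubs only (L3 proved above). -/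
theorem ubiquitousSliceLiouville_of (hL1 : DissipationBudget) (hL2 : ViolatorDissipation) : UbiquitousSliceLiouville :=
  ubiquitousSliceLiouville_of_ledger ledgerCount_holds hL1 hL2


/-! ## §3 The three registered stubs (C1 heart · L1 · L2) and their registration-style names (C2 was a stub in rev 1–2; it is proved in §2 since rev 3) -/

/-- C1 stub — THE HEART (static; see its docstring). -/
theorem stub_nearExtremiserUbiquity : NearExtremiserUbiquity := by
  sorry

/-- L1 stub (provable, L). -/
theorem stub_dissipationBudget : DissipationBudget := by
  sorry

/-- L2 stub (provable, M). -/
theorem stub_violatorDissipation : ViolatorDissipation := by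
  sorry

/-! Registration-style names: the skeleton theorem's hypotheses are typed by these, so that `ledger skeleton check` matches each
hypothesis to its declared stub BY NAME (pattern of `Lines/filament_selection.lean` §2b). -/
namespace Registered

/-- C1 -/
abbrev stub_nearExtremiserUbiquity : Prop := NearExtremiserUbiquity
/-- L1 -/
abbrev stub_dissipationBudget : Prop := DissipationBudget
/-- L2 -/
abbrev stub_violatorDissipation : Prop := ViolatorDissipation

end Registered

/-! ## §4 THE SKELETON: C1 + L1 + L2 ⇒ the crux BY NAME (kernel-checked, no `sorry` outside the three stubs; F1, T0, T2′, G′, C2, L3 and the propagation are theorems) -/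

/-- **LINE g10-α SKELETON — the crux from the three stubs C1, L1, L2 (via the ubiquitous-slice Liouville theorem; C2 and L3 proved in §2).**  Violator frame by contradiction → F1 budget `A` (`flowFilamentBudget`) →
T0 data (`efficientTimesNoDust_holds`) → T2′ zoom family + flow compactness (`zoomPackageFlow`) → growth of the members (`ballEnergy_zoom_le`) →
C1 eventually at every radius `d` → diagonal subsequence and centres (`Filter.extraction_forall_of_eventually`) → limit field `W`, slice `W s` →
C2: `W s` radially ubiquitous → G′ (`growthTransferFlow`): all-time growth → `UbiquitousSliceLiouville`: contradiction. -/
theorem NearExtremalTransiencePerFlow_of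
    (hC1 : Registered.stub_nearExtremiserUbiquity)
    (hL1 : Registered.stub_dissipationBudget) (hL2 : Registered.stub_violatorDissipation) :
    NearExtremalTransiencePerFlow := by
  -- the ledger's Liouville theorem from L1, L2 (L3 and the backward-cone propagation are theorems)
  have hL : UbiquitousSliceLiouville := ubiquitousSliceLiouville_of hL1 hL2
  have hT0 : EfficientTimesNoDust := efficientTimesNoDust_holds
  intro C ν T hC hν hT u p hsol hLH hdec hrate hsing
  by_contra hno
  have hV : IsViolator C ν T u p := ⟨hC, hν, hT, hsol, hLH, hdec, hrate, hsing, hno⟩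
  -- F1: the filament budget of the flow (landed)
  obtain ⟨A, hA⟩ := FilamentGap.flowFilamentBudget C ν T hC hν hT u p hsol hLH hdec hrate
  -- T0: near-efficient late times with a Taylor bound (landed)
  obtain ⟨Θ, t, Mb, ε, hdata⟩ := hT0 C ν T u p hV
  -- T2′: zoom family and flow-level compactness (landed)
  obtain ⟨σ, Λ, Θ', ε', hσ, hfam, hcompF⟩ := FilamentSelection.zoomPackageFlow C ν T u p hV Θ t Mb ε hdata
  -- the zoom family
  set V : ℕ → E3 → E3 := fun n z => (Mb (σ n))⁻¹ • u (t (σ n)) ((ν / Mb (σ n)) • z) with hVdef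
  obtain ⟨hcd, hdiv, hle1, hder, hfin, hε0, hpos, heff, htay⟩ := hfam
  -- growth of the members, eventually (F1 + scale invariance of the budget)
  have htT : Tendsto (fun n => t (σ n)) atTop (𝓝[<] T) := by
    have h1 : Tendsto (fun n => t (σ n)) atTop (𝓝 T) := hdata.2.1.comp hσ.tendsto_atTop
    exact tendsto_nhdsWithin_iff.2 ⟨h1, Eventually.of_forall fun n => (hdata.1 (σ n)).2⟩
  have hgrV : ∀ᶠ n in atTop, ∀ (x : E3) (R : ℝ), 0 < R → ∫ z in Metric.ball x R, ‖V n z‖ ^ 2 ≤ A * R := by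
    filter_upwards [htT.eventually hA] with n hn x R hR
    have h := FilamentSelection.ballEnergy_zoom_le hν (hdata.2.2.2.1 (σ n)) hn 0 x hR
    simpa only [zero_add] using h
  -- C1: thickness `g`; for each radius `d`, eventually the member is ubiquitous up to `d` about some centre
  obtain ⟨g, hg, hC1g⟩ := hC1 Λ Θ' A
  have hev : ∀ d : ℕ, ∀ᶠ n in atTop, ∃ y : E3, ∀ r : ℝ, 0 ≤ r → r ≤ (d : ℝ) →
      ∃ z : E3, |‖z - y‖ - r| ≤ g ∧ (1 / 2 : ℝ) ≤ ‖V n z‖ := by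
    intro d
    obtain ⟨e, he, hCe⟩ := hC1g d
    have hεe : ∀ᶠ n in atTop, ε' n < e := (tendsto_order.1 hε0).2 e he
    filter_upwards [hgrV, hεe] with n hgr hεn
    have hnn : 0 ≤ Real.sqrt (∫ x, ‖curl (V n) x‖ ^ 2) * Real.sqrt (∫ x, frobeniusNormSq (fderiv ℝ (curl (V n)) x)) :=
      mul_nonneg (Real.sqrt_nonneg _) (Real.sqrt_nonneg _)
    have heffe : (kStar - e) * Real.sqrt (∫ x, ‖curl (V n) x‖ ^ 2) *
        Real.sqrt (∫ x, frobeniusNormSq (fderiv ℝ (curl (V n)) x)) ≤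
        |∫ x, ⟪curl (V n) x, fderiv ℝ (V n) x (curl (V n) x)⟫_ℝ| := by
      refine le_trans ?_ (heff n)
      rw [mul_assoc, mul_assoc]
      exact mul_le_mul_of_nonneg_right (by linarith) hnn
    exact hCe (V n) (hcd n) (hdiv n) (hle1 n) (fun k x => hder k n x) (hfin n).1 (hfin n).2 (hpos n) heffe (htay n) hgr
  -- diagonal: a subsequence `φ` with the `d`-th member ubiquitous up to radius `d` about `c d`
  obtain ⟨φ, hφ, hφP⟩ := extraction_forall_of_eventually hev
  choose c hc using hφP
  -- centres on the original indices
  let y : ℕ → E3 := fun m => c (Function.invFun φ m)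
  have hy : ∀ d, y (φ d) = c d := fun d => by
    show c (Function.invFun φ (φ d)) = c d
    rw [Function.leftInverse_invFun hφ.injective d]
  -- T2′ compactness at these centres
  obtain ⟨ψ, K, s, W, hψ, hW, hs, hpin, hconvF⟩ := hcompF y φ hφ
  -- the slice family is the instance `τ = s` of the flow-level convergence
  have hconv' : ∀ z : E3, Tendsto (fun n => V (φ (ψ n)) (c (ψ n) + z)) atTop (𝓝 (W s z)) := by
    intro z
    have h1 := hconvF s hs z
    simp only [sub_self, mul_zero, add_zero] at h1
    refine h1.congr' (Eventually.of_forall fun n => ?_)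
    show (Mb (σ (φ (ψ n))))⁻¹ • u (t (σ (φ (ψ n)))) ((ν / Mb (σ (φ (ψ n)))) • (y (φ (ψ n)) + z)) =
      V (φ (ψ n)) (c (ψ n) + z)
    rw [hy]
  -- C2 (proved): the limit slice is radially ubiquitous
  have hub : RadiallyUbiquitous (g + 1) ((1 / 2 : ℝ) / 2) (W s) := by
    refine ubiquityToLimit_holds (fun n => V (φ (ψ n))) (Λ 1) g (1 / 2) (fun n => c (ψ n)) (fun n => ((ψ n : ℕ) : ℝ)) (W s)
      (fun n => hcd _) (fun n x => hder 1 _ x) ?_ (fun n => hc (ψ n)) hconv'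
    exact tendsto_natCast_atTop_atTop.comp hψ.tendsto_atTop
  -- G′ at every rescaled time (landed)
  have htT' : Tendsto (fun n => t (σ (φ (ψ n)))) atTop (𝓝 T) :=
    hdata.2.1.comp ((hσ.comp (hφ.comp hψ)).tendsto_atTop)
  have hgrowthAll : HasLinGrowthAllTime A W := by
    intro τ hτ
    exact FilamentSelection.growthTransferFlow ν A T u (fun n => t (σ (φ (ψ n)))) (fun n => Mb (σ (φ (ψ n))))
      (fun n => y (φ (ψ n))) s τ (W τ) hν hT (fun n => hdata.2.2.2.1 _) (fun n => (hdata.1 _).2) htT'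
      (fun t' ht' => (hsol.contDiff_velocity ht').continuous) hA hs hpin hτ (hconvF τ hτ)
  -- the ledger's Liouville theorem
  exact hL K A (g + 1) ((1 / 2 : ℝ) / 2) W s hW hs (by norm_num) hgrowthAll hub

/-- Sanity: the skeleton applied to the three `sorry`-stubs elaborates and concludes the route decl (an `example`, so that the
skeleton theorem above is the ONLY declaration concluding the crux). -/
example : NearExtremalTransiencePerFlow :=
  NearExtremalTransiencePerFlow_of stub_nearExtremiserUbiquity stub_dissipationBudget stub_violatorDissipation

end Summit.NavierStokesRegularity.NavierStokesRegularity.Cruxes.NearExtremalTransiencePerFlow.DissipationLedger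

end
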